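import Summits.CriticalPhenomena.PercolationContinuityZ3.Theorems.PercNearOneGluingNoHeavyLowerTailObserverExchangeTools
import HarnessLib

/-!
# `NoHeavyLowerTail` (stmt-CriticalPhenomena-4575) — three relays: the OBSERVER-EXCHANGE reduction of KN Question 7
part 2 (assembly)  (depth prover `nh-dp-commonrelay`, gen 7)

Support file (`--supports stmt-CriticalPhenomena-4575`); no definitions, no named facts, no sorries.
Setting of Kozma–Nitzan's Theorem 2 (arXiv:2401.12397, pp. 8–9): relays `a₁, a₂, a₃` (designated `a₃`, `τ₃ ≤ τ₁, τ₂`),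
observer `o`, target `b`; `N₁ = {a₁ ↮ a₂, a₃}`, `N₂ = {a₂ ↮ a₁, a₃}`, `N₁₂ = {a₃ ↮ a₁, a₂}`, `W₃ = N₁₂ ∩ {a₁ ↔ a₂}`,
`P_j = μ(N_j)`, `A_j = μ(N_j ∩ {a_j ↔ o})` (`φ_j = A_j / P_j`), `τ_j = μ(a_j ↔ b)`,
`A₃ := μ(W₃, b ↔ a₁, a₂) − μ(W₃, b ↔ a₃)` (`≥ 0` under `τ₃ ≤ τ₁`, KN Lemma 3(i)), and the exchange functional
`L₁(Q) := μ(Q, a₁ ↔ b) − μ(Q, a₃ ↔ b)`.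

MAIN RESULT `preFKG3_of_observerExchange`: pre-FKG (3) at `a₃` (KN Question 7 for three relays) follows from the SINGLE
inequality
  `[K]  P₂ A₁ (τ₁ − τ₃) + P₁ A₂ A₃ ≤ P₁ P₂ · L₁({o ↔ a₁})`,  i.e.  `μ(o↔a₁↔b) − μ(o↔a₁, a₃↔b) ≥ φ₁ (τ₁ − τ₃) + φ₂ A₃`
(registered stub `stub_observerExchangeThreeRelays`, both minimiser hypotheses kept).  Mechanism (memo RESIDUAL-gen7.md in
run/shared/lean/prim/prim-nh-dp-commonrelay/): with `TOT3 := X − φ₁(τ₁−τ₃) − φ₂(τ₂−τ₃)` (`X = μ(o↔A,o↔b) − μ(o↔A,a₃↔b)`) one has the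
exact identity `TOT3 = [K]/(P₁P₂) + cov₂ / P₂` where `cov₂ := P₂ (T₂ − V₂) − A₂ (μ(N₂, a₂↔b) − μ(N₂, a₃↔b)) ≥ 0` is a van den
Berg–Häggström–Kahn covariance on `N₂` (Thm. 1.3 for `{a₂↔o},{a₂↔b}` ⊂ C(a₂)` and Thm. 1.4 for `{a₂↔o}` vs `{a₃↔b} ⊂ C({a₁,a₃})`),
PROVED here (`obs_cov2`).  So the whole 3-relay rung reduces to `[K]`, which is `TW3 + cov₁` with `TW3 := α' − (φ₁+φ₂)A₃` the
glued-world row of the memo (the ONE-SIDED forms of `TW3`, of sector (I) and of sector (II) are all false: `…SectorClaimIOneSidedCex`,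
`…SectorOneSidedCex`; `[K]` has 0 violations in all censuses so far, see the memo).
Contents of THIS file: the arithmetic `obs_arith`, the assembly on the Theorem-2 split terms `preFKG3_of_observerExchangeT`, its clean form
`preFKG3_of_observerExchange`, and `preFKG3_of_stubObserverExchange` (the registered stub verbatim).  Tools (BHK cross form, `cov₂ ≥ 0`,
bookkeeping identities) are in `…ObserverExchangeTools.lean`.
[cite: KozmaNitzan2024, Theorem 2 (§3.1, pp. 8–9), Lemma 3 (pp. 6–7), Question 7 (§5.5, p. 36); VandenbergHaggstromKahn2005, Thms. 1.3–1.4]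
-/

namespace Summit.CriticalPhenomena.PercolationContinuityZ3.Theorems

open MeasureTheory Set Literature.Probability.LatticeModels Literature.Probability.Percolation

noncomputable section
open Classical

variable {n : ℕ}

/-! ### Arithmetic and the assembly -/

/-- **Arithmetic of the observer-exchange assembly.**  With `X = (T₁₂ − U₁₂) + (T₁ − U₁) + (T₂ − U₂)`,
`[K]: P₂ A₁ t₁ + P₁ A₂ A₃ ≤ P₁ P₂ ((T₁₂ − U₁₂) + I₂ + (T₁ − U₁))`, `cov₂: A₂ (m₂ − t₃) ≤ P₂ (T₂ − V₂)`, `V₂ = U₂ + I₂`,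
`t₂ − A₃ = m₂ − t₃`, one gets `P₁ P₂ X ≥ P₂ A₁ t₁ + P₁ A₂ t₂ ≥ 0`, hence `X ≥ 0`. [this file] -/
theorem obs_arith {X T₁₂ U₁₂ T₁ U₁ T₂ U₂ P₁ P₂ A₁ A₂ A₃ I₂ V₂ t₁ t₂ m₂ t₃ : ℝ}
    (hX : X = (T₁₂ - U₁₂) + (T₁ - U₁) + (T₂ - U₂))
    (hP₁ : 0 < P₁) (hP₂ : 0 < P₂) (hA₁ : 0 ≤ A₁) (hA₂ : 0 ≤ A₂) (ht₁ : 0 ≤ t₁) (ht₂ : 0 ≤ t₂)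
    (hK : P₂ * A₁ * t₁ + P₁ * A₂ * A₃ ≤ P₁ * P₂ * ((T₁₂ - U₁₂) + I₂ + (T₁ - U₁)))
    (hcov : A₂ * (m₂ - t₃) ≤ P₂ * (T₂ - V₂)) (hV : V₂ = U₂ + I₂) (ht : t₂ - A₃ = m₂ - t₃) : 0 ≤ X := by
  have h1 : A₂ * (t₂ - A₃) ≤ P₂ * (T₂ - U₂ - I₂) := by
    rw [ht]
    have hc := hcov
    rw [hV] at hc
    linarith
  have h2 : P₁ * (A₂ * (t₂ - A₃)) ≤ P₁ * (P₂ * (T₂ - U₂ - I₂)) :=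
    mul_le_mul_of_nonneg_left h1 hP₁.le
  have hsum : P₂ * A₁ * t₁ + P₁ * A₂ * t₂ ≤ P₁ * P₂ * X := by
    rw [hX]; nlinarith [hK, h2]
  have hnn : 0 ≤ P₂ * A₁ * t₁ + P₁ * A₂ * t₂ := by positivity
  have hprod : 0 < P₁ * P₂ := mul_pos hP₁ hP₂
  by_contra hneg
  push Not at hneg
  have : P₁ * P₂ * X < 0 := mul_neg_of_pos_of_neg hprod hneg
  linarith

/-- **KN Question 7 at three relays from the OBSERVER-EXCHANGE inequality `[K]` (T-form).**  Relays pairwise distinct,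
`τ₃ ≤ τ₁`, `τ₃ ≤ τ₂`, `μ(M) > 0`, and `[K]` written on the Theorem-2 split terms:
`P₂ A₁ (τ₁−τ₃) + P₁ A₂ A₃ ≤ P₁ P₂ ((T₁₂ − U₁₂) + I₂ + (T₁ − U₁))` with `I₂ = μ(M ∩ {a₂↔o} ∩ {a₃↔b})`
(by `obs_L1_split` the bracket equals `L₁({o↔a₁}) = μ(o↔a₁↔b) − μ(o↔a₁, a₃↔b)`).  Then
`μ(o↔A, a₃↔b) ≤ μ(o↔A, o↔b)`.  Proof: `X = I + II + III` (`stub_knThm2GoodSplit`), `obs_cov2`, `obs_V2_split`,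
`obs_t2_sub`, `obs_arith`. [cite: KozmaNitzan2024, Theorem 2 (pp. 8–9), Question 7 (p. 36)] -/
theorem preFKG3_of_observerExchangeT (w : Sym2 (Fin n) → unitInterval) (o b a₁ a₂ a₃ : Fin n)
    (h12 : a₁ ≠ a₂) (h23 : a₂ ≠ a₃)
    (hM : 0 < (prodBernoulli w).real ((openConn a₁ a₂)ᶜ ∩ (openConn a₁ a₃)ᶜ ∩ (openConn a₂ a₃)ᶜ : Set (BondConfig (Fin n))))
    (hτ₁ : (prodBernoulli w).real (openConn a₃ b) ≤ (prodBernoulli w).real (openConn a₁ b))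
    (hτ₂ : (prodBernoulli w).real (openConn a₃ b) ≤ (prodBernoulli w).real (openConn a₂ b))
    (hK : (prodBernoulli w).real ((openConn a₂ a₁)ᶜ ∩ (openConn a₂ a₃)ᶜ : Set (BondConfig (Fin n))) *
            (prodBernoulli w).real ((openConn a₁ a₂)ᶜ ∩ (openConn a₁ a₃)ᶜ ∩ openConn a₁ o) *
            ((prodBernoulli w).real (openConn a₁ b) - (prodBernoulli w).real (openConn a₃ b)) +
          (prodBernoulli w).real ((openConn a₁ a₂)ᶜ ∩ (openConn a₁ a₃)ᶜ : Set (BondConfig (Fin n))) *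
            (prodBernoulli w).real ((openConn a₂ a₁)ᶜ ∩ (openConn a₂ a₃)ᶜ ∩ openConn a₂ o) *
            ((prodBernoulli w).real ((openConn a₁ a₃)ᶜ ∩ (openConn a₂ a₃)ᶜ ∩ (openConn a₁ b ∩ openConn a₂ b)) -
              (prodBernoulli w).real ((openConn a₁ a₃)ᶜ ∩ (openConn a₂ a₃)ᶜ ∩ (openConn a₁ a₂ ∩ openConn a₃ b))) ≤
        (prodBernoulli w).real ((openConn a₁ a₂)ᶜ ∩ (openConn a₁ a₃)ᶜ : Set (BondConfig (Fin n))) *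
          (prodBernoulli w).real ((openConn a₂ a₁)ᶜ ∩ (openConn a₂ a₃)ᶜ : Set (BondConfig (Fin n))) *
          (((prodBernoulli w).real ((openConn a₁ a₃)ᶜ ∩ (openConn a₂ a₃)ᶜ ∩ ((openConn a₁ o ∪ openConn a₂ o) ∩ (openConn a₁ b ∩ openConn a₂ b))) -
              (prodBernoulli w).real ((openConn a₁ a₃)ᶜ ∩ (openConn a₂ a₃)ᶜ ∩ ((openConn a₁ o ∪ openConn a₂ o) ∩ openConn a₃ b))) +
            (prodBernoulli w).real ((openConn a₂ a₁)ᶜ ∩ (openConn a₂ a₃)ᶜ ∩ (openConn a₁ a₃)ᶜ ∩ (openConn a₂ o ∩ openConn a₃ b)) +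
            ((prodBernoulli w).real ((openConn a₁ a₂)ᶜ ∩ (openConn a₁ a₃)ᶜ ∩ (openConn a₁ o ∩ openConn a₁ b)) -
              (prodBernoulli w).real ((openConn a₁ a₂)ᶜ ∩ (openConn a₁ a₃)ᶜ ∩ (openConn a₁ o ∩ (openConn a₂ b ∩ openConn a₃ b)))))) :
    (prodBernoulli w).real ((openConn o a₁ ∪ openConn o a₂ ∪ openConn o a₃) ∩ openConn a₃ b) ≤
      (prodBernoulli w).real ((openConn o a₁ ∪ openConn o a₂ ∪ openConn o a₃) ∩ openConn o b) := by
  have hX := stub_knThm2GoodSplit n w o b a₁ a₂ a₃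
  -- `P₁, P₂ ≥ P_M > 0`
  have hP₁ : (prodBernoulli w).real ((openConn a₁ a₂)ᶜ ∩ (openConn a₁ a₃)ᶜ ∩ (openConn a₂ a₃)ᶜ : Set (BondConfig (Fin n))) ≤
      (prodBernoulli w).real ((openConn a₁ a₂)ᶜ ∩ (openConn a₁ a₃)ᶜ : Set (BondConfig (Fin n))) :=
    measureReal_mono Set.inter_subset_left
  have hsub₂ : ((openConn a₁ a₂)ᶜ ∩ (openConn a₁ a₃)ᶜ ∩ (openConn a₂ a₃)ᶜ : Set (BondConfig (Fin n))) ⊆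
      (openConn a₂ a₁)ᶜ ∩ (openConn a₂ a₃)ᶜ := by
    intro ω hω
    simp only [Set.mem_inter_iff, Set.mem_compl_iff, knThm2_mem_openConn] at hω ⊢
    exact ⟨fun h => hω.1.1 h.symm, hω.2⟩
  have hP₂ := measureReal_mono (μ := prodBernoulli w) hsub₂
  have hcov := obs_cov2 w o b a₁ a₂ a₃ h12 h23
  have hV := obs_V2_split w o b a₁ a₂ a₃
  have ht := obs_t2_sub w b a₁ a₂ a₃
  have key := obs_arith (sub_eq_of_eq_add' (by linarith [hX] :
      (prodBernoulli w).real ((openConn o a₁ ∪ openConn o a₂ ∪ openConn o a₃) ∩ openConn o b) =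
        (prodBernoulli w).real ((openConn o a₁ ∪ openConn o a₂ ∪ openConn o a₃) ∩ openConn a₃ b) +
          (((prodBernoulli w).real ((openConn a₁ a₃)ᶜ ∩ (openConn a₂ a₃)ᶜ ∩ ((openConn a₁ o ∪ openConn a₂ o) ∩ (openConn a₁ b ∩ openConn a₂ b))) -
              (prodBernoulli w).real ((openConn a₁ a₃)ᶜ ∩ (openConn a₂ a₃)ᶜ ∩ ((openConn a₁ o ∪ openConn a₂ o) ∩ openConn a₃ b))) +
            ((prodBernoulli w).real ((openConn a₁ a₂)ᶜ ∩ (openConn a₁ a₃)ᶜ ∩ (openConn a₁ o ∩ openConn a₁ b)) -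
              (prodBernoulli w).real ((openConn a₁ a₂)ᶜ ∩ (openConn a₁ a₃)ᶜ ∩ (openConn a₁ o ∩ (openConn a₂ b ∩ openConn a₃ b)))) +
            ((prodBernoulli w).real ((openConn a₂ a₁)ᶜ ∩ (openConn a₂ a₃)ᶜ ∩ (openConn a₂ o ∩ openConn a₂ b)) -
              (prodBernoulli w).real ((openConn a₂ a₁)ᶜ ∩ (openConn a₂ a₃)ᶜ ∩ (openConn a₂ o ∩ (openConn a₁ b ∩ openConn a₃ b)))))))
    (lt_of_lt_of_le hM hP₁) (lt_of_lt_of_le hM hP₂) measureReal_nonneg measureReal_nonneg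
    (sub_nonneg.2 hτ₁) (sub_nonneg.2 hτ₂) hK hcov hV ht
  linarith

/-- **KN Question 7 at three relays from the OBSERVER-EXCHANGE inequality `[K]` (clean form = the registered
`stub_observerExchangeThreeRelays`).**  Relays pairwise distinct, `τ₃ ≤ τ₁`, `τ₃ ≤ τ₂`, `μ(M) > 0`, and
`[K]  P₂ A₁ (τ₁ − τ₃) + P₁ A₂ A₃ ≤ P₁ P₂ (μ(o↔a₁, a₁↔b) − μ(o↔a₁, a₃↔b))`
(`A₃ = μ(N₁₂, a₁↔b, a₂↔b) − μ(N₁₂, a₁↔a₂, a₃↔b)`; i.e. `L₁({o↔a₁}) ≥ φ₁ (τ₁−τ₃) + φ₂ A₃`).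
Then `μ(o↔A, a₃↔b) ≤ μ(o↔A, o↔b)` (pre-FKG (3) at `a₃`).  [cite: KozmaNitzan2024, Theorem 2 (pp. 8–9), Question 7 (p. 36)] -/
theorem preFKG3_of_observerExchange (w : Sym2 (Fin n) → unitInterval) (o b a₁ a₂ a₃ : Fin n)
    (h12 : a₁ ≠ a₂) (h23 : a₂ ≠ a₃)
    (hM : 0 < (prodBernoulli w).real ((openConn a₁ a₂)ᶜ ∩ (openConn a₁ a₃)ᶜ ∩ (openConn a₂ a₃)ᶜ : Set (BondConfig (Fin n))))
    (hτ₁ : (prodBernoulli w).real (openConn a₃ b) ≤ (prodBernoulli w).real (openConn a₁ b))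
    (hτ₂ : (prodBernoulli w).real (openConn a₃ b) ≤ (prodBernoulli w).real (openConn a₂ b))
    (hK : (prodBernoulli w).real ((openConn a₂ a₁)ᶜ ∩ (openConn a₂ a₃)ᶜ : Set (BondConfig (Fin n))) *
            (prodBernoulli w).real ((openConn a₁ a₂)ᶜ ∩ (openConn a₁ a₃)ᶜ ∩ openConn a₁ o) *
            ((prodBernoulli w).real (openConn a₁ b) - (prodBernoulli w).real (openConn a₃ b)) +
          (prodBernoulli w).real ((openConn a₁ a₂)ᶜ ∩ (openConn a₁ a₃)ᶜ : Set (BondConfig (Fin n))) *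
            (prodBernoulli w).real ((openConn a₂ a₁)ᶜ ∩ (openConn a₂ a₃)ᶜ ∩ openConn a₂ o) *
            ((prodBernoulli w).real ((openConn a₁ a₃)ᶜ ∩ (openConn a₂ a₃)ᶜ ∩ (openConn a₁ b ∩ openConn a₂ b)) -
              (prodBernoulli w).real ((openConn a₁ a₃)ᶜ ∩ (openConn a₂ a₃)ᶜ ∩ (openConn a₁ a₂ ∩ openConn a₃ b))) ≤
        (prodBernoulli w).real ((openConn a₁ a₂)ᶜ ∩ (openConn a₁ a₃)ᶜ : Set (BondConfig (Fin n))) *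
          (prodBernoulli w).real ((openConn a₂ a₁)ᶜ ∩ (openConn a₂ a₃)ᶜ : Set (BondConfig (Fin n))) *
          ((prodBernoulli w).real (openConn a₁ o ∩ openConn a₁ b) - (prodBernoulli w).real (openConn a₁ o ∩ openConn a₃ b))) :
    (prodBernoulli w).real ((openConn o a₁ ∪ openConn o a₂ ∪ openConn o a₃) ∩ openConn a₃ b) ≤
      (prodBernoulli w).real ((openConn o a₁ ∪ openConn o a₂ ∪ openConn o a₃) ∩ openConn o b) := by
  rw [obs_L1_split] at hK
  exact preFKG3_of_observerExchangeT w o b a₁ a₂ a₃ h12 h23 hM hτ₁ hτ₂ hK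

/-- **pre-FKG (3) at `a₃` from the REGISTERED stub `stub_observerExchangeThreeRelays` (verbatim, as hypothesis `hK`).**
[cite: KozmaNitzan2024, Question 7 (p. 36)] -/
theorem preFKG3_of_stubObserverExchange
    (hK : ∀ (n : ℕ) (w : Sym2 (Fin n) → unitInterval) (o b a₁ a₂ a₃ : Fin n), a₁ ≠ a₂ → a₁ ≠ a₃ → a₂ ≠ a₃ → o ≠ a₁ → o ≠ a₂ → o ≠ a₃ → b ≠ a₁ → b ≠ a₂ → b ≠ a₃ → o ≠ b → (prodBernoulli w).real (openConn a₃ b) ≤ (prodBernoulli w).real (openConn a₁ b) → (prodBernoulli w).real (openConn a₃ b) ≤ (prodBernoulli w).real (openConn a₂ b) → (prodBernoulli w).real ((openConn a₂ a₁)ᶜ ∩ (openConn a₂ a₃)ᶜ : Set (BondConfig (Fin n))) * (prodBernoulli w).real ((openConn a₁ a₂)ᶜ ∩ (openConn a₁ a₃)ᶜ ∩ openConn a₁ o) * ((prodBernoulli w).real (openConn a₁ b) - (prodBernoulli w).real (openConn a₃ b)) + (prodBernoulli w).real ((openConn a₁ a₂)ᶜ ∩ (openConn a₁ a₃)ᶜ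 : Set (BondConfig (Fin n))) * (prodBernoulli w).real ((openConn a₂ a₁)ᶜ ∩ (openConn a₂ a₃)ᶜ ∩ openConn a₂ o) * ((prodBernoulli w).real ((openConn a₁ a₃)ᶜ ∩ (openConn a₂ a₃)ᶜ ∩ (openConn a₁ b ∩ openConn a₂ b)) - (prodBernoulli w).real ((openConn a₁ a₃)ᶜ ∩ (openConn a₂ a₃)ᶜ ∩ (openConn a₁ a₂ ∩ openConn a₃ b))) ≤ (prodBernoulli w).real ((openConn a₁ a₂)ᶜ ∩ (openConn a₁ a₃)ᶜ : Set (BondConfig (Fin n))) * (prodBernoulli w).real ((openConn a₂ a₁)ᶜ ∩ (openConn a₂ a₃)ᶜ : Set (BondConfig (Fin n))) * ((prodBernoulli w).real (openConn a₁ o ∩ openConn a₁ b) - (prodBernoulli w).real (openConn a₁ o ∩ openConn a₃ b)))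
    (w : Sym2 (Fin n) → unitInterval) (o b a₁ a₂ a₃ : Fin n)
    (h12 : a₁ ≠ a₂) (h13 : a₁ ≠ a₃) (h23 : a₂ ≠ a₃) (ho1 : o ≠ a₁) (ho2 : o ≠ a₂) (ho3 : o ≠ a₃)
    (hb1 : b ≠ a₁) (hb2 : b ≠ a₂) (hb3 : b ≠ a₃) (hob : o ≠ b)
    (hM : 0 < (prodBernoulli w).real ((openConn a₁ a₂)ᶜ ∩ (openConn a₁ a₃)ᶜ ∩ (openConn a₂ a₃)ᶜ : Set (BondConfig (Fin n))))
    (hτ₁ : (prodBernoulli w).real (openConn a₃ b) ≤ (prodBernoulli w).real (openConn a₁ b))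
    (hτ₂ : (prodBernoulli w).real (openConn a₃ b) ≤ (prodBernoulli w).real (openConn a₂ b)) :
    (prodBernoulli w).real ((openConn o a₁ ∪ openConn o a₂ ∪ openConn o a₃) ∩ openConn a₃ b) ≤
      (prodBernoulli w).real ((openConn o a₁ ∪ openConn o a₂ ∪ openConn o a₃) ∩ openConn o b) :=
  preFKG3_of_observerExchange w o b a₁ a₂ a₃ h12 h23 hM hτ₁ hτ₂
    (hK n w o b a₁ a₂ a₃ h12 h13 h23 ho1 ho2 ho3 hb1 hb2 hb3 hob hτ₁ hτ₂)

end

end Summit.CriticalPhenomena.PercolationContinuityZ3.Theorems
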